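import Summits.QuantumFields.BalabanUV.T4Continuum.Support.VariationalCovariantAssembly

/-!
# T⁴ programme, spine node NE2 (U1a), lane P2 — LEAF UB⁺ IS NOT AN INDEPENDENT LEAF: the upper half of the bracket needs the upper bound
# only at the COARSE level, and then PRODUCES it at the fine level; so UB⁺ propagates up the tower from the trivial level 0
# (`t4/skeletons/NE2-t4-ne2-p2.md` v0.7 §2.C/§3; cell `pub-balaban`, row NE2 co-owner #2, lineage t4-ne2-p2 gen 10)

HONEST FRAMING (T4-DAG p. 1).  Rung (B)+1 only — NOT infinite volume, NOT a mass gap, NOT Clay.  NE2 is NOT IN PRINT and NOT proved here.  Abstract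
carriers as in `Support/VariationalCovariantAssembly` (finite-dimensional normed spaces, nonnegative actions, sizes, a regularity functional); the leaves
enter as HYPOTHESES OF EXACTLY THEIR TYPED SHAPE; nothing printed is a hypothesis; no `def … : Prop` fact; no `sorry`; axioms standard.

WHAT THIS FILE PROVES (kernel bookkeeping of the variational route, all [folklore]):
 * `upper_half` — the UPPER half of the canonical-pair bracket, `Δ_{k+1}(μ) ≤ Δ_k(μ) + e′·qZ μ`, `e′ = (ε₁C_R + ε₂C_P)(Λ+1)`, needs UB⁺ ONLY AT THE COARSE LEVEL
   (plus P⁺ coarse, ONE⁺, REG⁺, surjectivity of the one-step average) — NOT the fine-level UB⁺ that `pair_bracket` also assumed;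
 * `fine_ub_of_coarse` — hence the fine-level UB⁺ `∀ μ, ∃ g, Qk (Q₁ g) = μ ∧ Sf g ≤ (Λ + e′)·qZ μ` FOLLOWS (witness: the fine minimiser, which exists by
   compactness from the fine P⁺);
 * `ub_tower` — along an abstract tower of levels `W k` with one-step averages `Q₁ k : W (k+1) → W k`, composite averages `Qk (k+1) = Qk k ∘ Q₁ k`,
   actions `S k`, sizes `q k`: UB⁺ at level 0 with `Λ₀` and (P⁺, ONE⁺ with `ε₁ k, ε₂ k`, REG⁺) at every level give UB⁺ at EVERY level with
   `Λ (k+1) = Λ k + (ε₁ k·C_R + ε₂ k·C_P)(Λ k + 1)` (`LamSeq`), and `Λ k + 1 ≤ (Λ₀ + 1)·exp (Σ_{j<k} (ε₁ j·C_R + ε₂ j·C_P))` (`LamSeq_add_one_le`) —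
   uniformly bounded when the defects are summable (for the scalar covariant sector `ε₁ k ≍ L^{−2k}`, `ε₂ k ≍ α²L^{−2k}`).
So the analytic leaves of the background tier reduce to P⁺ (PROVED, p211276), FED⁺ (PROVED, p210720), ONE⁺ and REG⁺ (open), plus the trivial level-0
bound (`n = 1`: the constraint fixes the field; instantiation owed with `Support/VariationalCovariantScalarPair`).
HONEST DEPENDENCY (cell, verbatim): continuum YM on T⁴ ⇐ BetaPertH ∧ nine spine estimates (0/9 proved); BetaPertH ⇐ (D1) ∧ (D4) ∧ CAP+tail; G-an2-4
gates asym, D1 and NE2/3/4.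
-/

noncomputable section

namespace Summit.QuantumFields.BalabanUV.T4Continuum.VariationalCovariantUpper

open Set Finset
open Summit.QuantumFields.BalabanUV.T4Continuum.VariationalTransfer
open Summit.QuantumFields.BalabanUV.T4Continuum.VariationalAdditive
open Summit.QuantumFields.BalabanUV.T4Continuum.VariationalCovariantAssembly (exists_isMinOn_fib)

/-! ## §1 The upper half needs UB⁺ only at the coarse level, and produces it at the fine level -/

section OneStep

variable {V W Z : Type*} [NormedAddCommGroup V] [ProperSpace V] [NormedAddCommGroup W] [ProperSpace W] [TopologicalSpace Z] [T1Space Z]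

omit [NormedAddCommGroup V] [ProperSpace V] in
/-- **UPPER HALF OF THE BRACKET** from UB⁺ (coarse), P⁺ (coarse), ONE⁺, REG⁺: `T_{Qk∘Q₁} Sf (μ) ≤ T_{Qk} Sc (μ) + (ε₁C_R + ε₂C_P)(Λ+1)·qZ μ`. [folklore] -/
theorem upper_half
    {Qk : W → Z} {Q₁ : V → W} {Sc : W → ℝ} {Sf : V → ℝ} {qW : W → ℝ} {qZ : Z → ℝ} {ρ : W → ℝ}
    (hQk : Continuous Qk) (hSc : Continuous Sc) (hsurj : Function.Surjective Q₁)
    (hSc0 : ∀ f, 0 ≤ Sc f) (hSf0 : ∀ f', 0 ≤ Sf f')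
    {κ Λ CP CR ε₁ ε₂ : ℝ} (hκ : 0 ≤ κ) (hCP : 0 ≤ CP) (hCR : 0 ≤ CR) (hε₁ : 0 ≤ ε₁) (hε₂ : 0 ≤ ε₂)
    (hnormW : ∀ f, ‖f‖ ^ 2 ≤ κ * qW f)
    (hUBc : ∀ μ, ∃ f, Qk f = μ ∧ Sc f ≤ Λ * qZ μ)
    (hPc : ∀ f, qW f ≤ CP * (Sc f + qZ (Qk f)))
    (hONE : ∀ f, blockSpin Q₁ Sf f ≤ Sc f + ε₁ * ρ f + ε₂ * qW f)
    (hREG : ∀ μ f, Qk f = μ → (∀ g, Qk g = μ → Sc f ≤ Sc g) → ρ f ≤ CR * (Sc f + qZ μ))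
    (μ : Z) :
    blockSpin (Qk ∘ Q₁) Sf μ ≤ blockSpin Qk Sc μ + ((ε₁ * CR + ε₂ * CP) * (Λ + 1)) * qZ μ := by
  obtain ⟨fU, hfU, hfUb⟩ := hUBc μ
  obtain ⟨f₀, hf₀, hmin⟩ := exists_isMinOn_fib (qZ := qZ) hQk hSc hκ hCP hnormW hPc hfU
  have hSc_le : Sc f₀ ≤ Λ * qZ μ := (hmin fU hfU).trans hfUb
  have hqW_le : qW f₀ ≤ CP * (Λ + 1) * qZ μ := by
    calc qW f₀ ≤ CP * (Sc f₀ + qZ (Qk f₀)) := hPc f₀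
      _ ≤ CP * (Λ * qZ μ + qZ μ) := by rw [hf₀]; gcongr
      _ = CP * (Λ + 1) * qZ μ := by ring
  have hρ_le : ρ f₀ ≤ CR * (Λ + 1) * qZ μ := by
    calc ρ f₀ ≤ CR * (Sc f₀ + qZ μ) := hREG μ f₀ hf₀ hmin
      _ ≤ CR * (Λ * qZ μ + qZ μ) := by gcongr
      _ = CR * (Λ + 1) * qZ μ := by ring
  have hc : blockSpin Q₁ Sf f₀ ≤ Sc f₀ + ((ε₁ * CR + ε₂ * CP) * (Λ + 1)) * qZ μ := by
    have h := hONE f₀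
    nlinarith [mul_le_mul_of_nonneg_left hρ_le hε₁, mul_le_mul_of_nonneg_left hqW_le hε₂]
  rw [blockSpin_comp hsurj hSf0]
  exact blockSpin_upper_additive (fun _ => blockSpin_nonneg' hSf0) hSc0 hf₀ hmin hc

/-- **THE FINE-LEVEL UB⁺ FOLLOWS** (witness = the fine minimiser, which exists by compactness from the fine P⁺):
`∀ μ, ∃ g, Qk (Q₁ g) = μ ∧ Sf g ≤ (Λ + (ε₁C_R + ε₂C_P)(Λ+1))·qZ μ`. [folklore] -/
theorem fine_ub_of_coarse
    {Qk : W → Z} {Q₁ : V → W} {Sc : W → ℝ} {Sf : V → ℝ} {qW : W → ℝ} {qV : V → ℝ} {qZ : Z → ℝ} {ρ : W → ℝ}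
    (hQk : Continuous Qk) (hQ₁ : Continuous Q₁) (hSc : Continuous Sc) (hSf : Continuous Sf) (hsurj : Function.Surjective Q₁)
    (hSc0 : ∀ f, 0 ≤ Sc f) (hSf0 : ∀ f', 0 ≤ Sf f')
    {κW κV Λ CP CR ε₁ ε₂ : ℝ} (hκW : 0 ≤ κW) (hκV : 0 ≤ κV) (hCP : 0 ≤ CP) (hCR : 0 ≤ CR) (hε₁ : 0 ≤ ε₁) (hε₂ : 0 ≤ ε₂)
    (hnormW : ∀ f, ‖f‖ ^ 2 ≤ κW * qW f) (hnormV : ∀ f', ‖f'‖ ^ 2 ≤ κV * qV f')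
    (hUBc : ∀ μ, ∃ f, Qk f = μ ∧ Sc f ≤ Λ * qZ μ)
    (hPc : ∀ f, qW f ≤ CP * (Sc f + qZ (Qk f))) (hPf : ∀ f', qV f' ≤ CP * (Sf f' + qZ (Qk (Q₁ f'))))
    (hONE : ∀ f, blockSpin Q₁ Sf f ≤ Sc f + ε₁ * ρ f + ε₂ * qW f)
    (hREG : ∀ μ f, Qk f = μ → (∀ g, Qk g = μ → Sc f ≤ Sc g) → ρ f ≤ CR * (Sc f + qZ μ))
    (μ : Z) :
    ∃ g, Qk (Q₁ g) = μ ∧ Sf g ≤ (Λ + (ε₁ * CR + ε₂ * CP) * (Λ + 1)) * qZ μ := by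
  obtain ⟨fU, hfU, hfUb⟩ := hUBc μ
  obtain ⟨g₁, hg₁⟩ := hsurj fU
  have hg₁' : (Qk ∘ Q₁) g₁ = μ := by simp [hg₁, hfU]
  have hPf' : ∀ f', qV f' ≤ CP * (Sf f' + qZ ((Qk ∘ Q₁) f')) := fun f' => by simpa using hPf f'
  obtain ⟨g₀, hg₀, hmin'⟩ := exists_isMinOn_fib (Q := Qk ∘ Q₁) (qZ := qZ) (hQk.comp hQ₁) hSf hκV hCP hnormV hPf' hg₁'
  refine ⟨g₀, by simpa using hg₀, ?_⟩
  have hval : blockSpin (Qk ∘ Q₁) Sf μ = Sf g₀ := blockSpin_eq_of_isMin hSf0 hg₀ hmin'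
  have hup := upper_half (Λ := Λ) hQk hSc hsurj hSc0 hSf0 hκW hCP hCR hε₁ hε₂ hnormW hUBc hPc hONE hREG μ
  have hcoarse : blockSpin Qk Sc μ ≤ Λ * qZ μ := (blockSpin_le hSc0 hfU).trans hfUb
  rw [← hval]
  linarith

end OneStep

/-! ## §2 UB⁺ along the whole tower from level 0 -/

section Tower

/-- the propagated upper-bound constants: `Λ 0 = Λ₀`, `Λ (k+1) = Λ k + e k·(Λ k + 1)` (`e k = ε₁ k·C_R + ε₂ k·C_P`). [folklore] -/
def LamSeq (Λ₀ : ℝ) (e : ℕ → ℝ) : ℕ → ℝ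
  | 0 => Λ₀
  | k + 1 => LamSeq Λ₀ e k + e k * (LamSeq Λ₀ e k + 1)

/-- the recursion in multiplicative form: `Λ (k+1) + 1 = (Λ k + 1)·(1 + e k)`. [folklore] -/
theorem LamSeq_succ_add_one (Λ₀ : ℝ) (e : ℕ → ℝ) (k : ℕ) :
    LamSeq Λ₀ e (k + 1) + 1 = (LamSeq Λ₀ e k + 1) * (1 + e k) := by
  simp only [LamSeq]; ring

/-- `Λ k + 1 ≥ 0` along the recursion. [folklore] -/
theorem LamSeq_add_one_nonneg {Λ₀ : ℝ} {e : ℕ → ℝ} (hΛ₀ : 0 ≤ Λ₀ + 1) (he : ∀ j, 0 ≤ e j) :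
    ∀ k, 0 ≤ LamSeq Λ₀ e k + 1
  | 0 => by simpa [LamSeq] using hΛ₀
  | k + 1 => by
    rw [LamSeq_succ_add_one]
    exact mul_nonneg (LamSeq_add_one_nonneg hΛ₀ he k) (by linarith [he k])

/-- **Grönwall form**: `Λ k + 1 ≤ (Λ₀ + 1)·exp (Σ_{j<k} e j)` — uniformly bounded for summable defects `e`. [folklore] -/
theorem LamSeq_add_one_le {Λ₀ : ℝ} {e : ℕ → ℝ} (hΛ₀ : 0 ≤ Λ₀ + 1) (he : ∀ j, 0 ≤ e j) :
    ∀ k, LamSeq Λ₀ e k + 1 ≤ (Λ₀ + 1) * Real.exp (∑ j ∈ range k, e j)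
  | 0 => by simp [LamSeq]
  | k + 1 => by
    rw [LamSeq_succ_add_one, sum_range_succ, Real.exp_add, ← mul_assoc]
    exact mul_le_mul (LamSeq_add_one_le hΛ₀ he k) (by linarith [Real.add_one_le_exp (e k)]) (by linarith [he k])
      (mul_nonneg hΛ₀ (Real.exp_nonneg _))

variable {Z : Type*} [TopologicalSpace Z] [T1Space Z]

/-- **UB⁺ ALONG THE TOWER**: levels `W k` (finite-dimensional), one-step averages `Q₁ k : W (k+1) → W k`, composite averages to the unit data
`Qk k : W k → Z` with `Qk (k+1) = Qk k ∘ Q₁ k` ([Balaban1984PropagatorsI] (1.16)–(1.18) / [Balaban1985BackgroundPropagators] (3.15) shape),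
actions `S k`, sizes `q k`, regularity functionals `ρ k`; UB⁺ at level `0` with `Λ₀` and, at every level, P⁺ (`C_P`), ONE⁺ (`ε₁ k, ε₂ k`), REG⁺
(`C_R`) ⟹ UB⁺ at every level: `∀ k μ, ∃ f, Qk k f = μ ∧ S k f ≤ Λ k · qZ μ`, `Λ = LamSeq Λ₀ (k ↦ ε₁ k·C_R + ε₂ k·C_P)`. [folklore] -/
theorem ub_tower {W : ℕ → Type*} [∀ k, NormedAddCommGroup (W k)] [∀ k, ProperSpace (W k)]
    {Q₁ : ∀ k, W (k + 1) → W k} {Qk : ∀ k, W k → Z} (hcomp : ∀ k, Qk (k + 1) = Qk k ∘ Q₁ k)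
    {S : ∀ k, W k → ℝ} {q : ∀ k, W k → ℝ} {ρ : ∀ k, W k → ℝ} {qZ : Z → ℝ}
    (hQk : ∀ k, Continuous (Qk k)) (hQ₁ : ∀ k, Continuous (Q₁ k)) (hS : ∀ k, Continuous (S k)) (hsurj : ∀ k, Function.Surjective (Q₁ k))
    (hS0 : ∀ k f, 0 ≤ S k f)
    {κ : ℕ → ℝ} {CP CR Λ₀ : ℝ} {ε₁ ε₂ : ℕ → ℝ} (hκ : ∀ k, 0 ≤ κ k) (hCP : 0 ≤ CP) (hCR : 0 ≤ CR) (hε₁ : ∀ k, 0 ≤ ε₁ k) (hε₂ : ∀ k, 0 ≤ ε₂ k)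
    (hnorm : ∀ k (f : W k), ‖f‖ ^ 2 ≤ κ k * q k f)
    (hP : ∀ k (f : W k), q k f ≤ CP * (S k f + qZ (Qk k f)))
    (hONE : ∀ k (f : W k), blockSpin (Q₁ k) (S (k + 1)) f ≤ S k f + ε₁ k * ρ k f + ε₂ k * q k f)
    (hREG : ∀ k μ (f : W k), Qk k f = μ → (∀ g, Qk k g = μ → S k f ≤ S k g) → ρ k f ≤ CR * (S k f + qZ μ))
    (hUB0 : ∀ μ, ∃ f : W 0, Qk 0 f = μ ∧ S 0 f ≤ Λ₀ * qZ μ) :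
    ∀ k μ, ∃ f : W k, Qk k f = μ ∧ S k f ≤ LamSeq Λ₀ (fun j => ε₁ j * CR + ε₂ j * CP) k * qZ μ := by
  intro k
  induction k with
  | zero => simpa [LamSeq] using hUB0
  | succ k ih =>
    intro μ
    have hPf : ∀ f' : W (k + 1), q (k + 1) f' ≤ CP * (S (k + 1) f' + qZ (Qk k (Q₁ k f'))) := by
      intro f'
      have h := hP (k + 1) f'
      rwa [hcomp k] at h
    obtain ⟨g, hg, hgb⟩ := fine_ub_of_coarse (Qk := Qk k) (Q₁ := Q₁ k) (Sc := S k) (Sf := S (k + 1)) (qW := q k) (qV := q (k + 1))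
      (qZ := qZ) (ρ := ρ k) (Λ := LamSeq Λ₀ (fun j => ε₁ j * CR + ε₂ j * CP) k)
      (hQk k) (hQ₁ k) (hS k) (hS (k + 1)) (hsurj k) (hS0 k) (hS0 (k + 1)) (hκ k) (hκ (k + 1)) hCP hCR (hε₁ k) (hε₂ k)
      (hnorm k) (hnorm (k + 1)) ih (hP k) hPf (hONE k) (hREG k) μ
    refine ⟨g, by rw [hcomp k]; exact hg, ?_⟩
    simpa [LamSeq] using hgb

end Tower

end Summit.QuantumFields.BalabanUV.T4Continuum.VariationalCovariantUpper

end
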